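import Mathlib
import HarnessLib
import Literature.MathematicalPhysics.QuantumFieldTheory.ConstructiveQFTWave0
import Literature.MathematicalPhysics.QuantumLattice.AbelianFieldTensor
import Literature.MathematicalPhysics.QuantumLattice.AbelianMagneticFlux
import Summits.Ventures.LatticeQCDFlow.Scaling.TunnellingLaws
import Summits.Ventures.LatticeQCDFlow.Scaling.FluxPatch
import Summits.Ventures.LatticeQCDFlow.Scaling.SliceTwistWitness
import Summits.Ventures.LatticeQCDFlow.Scaling.RowFields
import Summits.Ventures.LatticeQCDFlow.Scaling.BalancedSliceTwist
import Summits.Ventures.LatticeQCDFlow.Scaling.BoxTouch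
import Summits.Ventures.LatticeQCDFlow.Scaling.BoxSpreadPair
import Summits.Ventures.LatticeQCDFlow.Scaling.ThinSectorsConnected

/-!
# The `ε`-sector tunnelling law at the pinned flux threshold (`U(1)`, `d = 2`)

HONEST FRAMING: exact (Metropolis-corrected) sampling algorithms for lattice gauge theory;
figures of merit are autocorrelation/cost numbers at stated couplings and volumes; no
continuum-physics claim.

Venture `LatticeQCDFlow` (cell pub-lqcd), topic `Scaling`, FANOUT row 29 (theory2, gen-22), item 111.
NEW WORK over Mathlib and the tree's `Scaling/{TunnellingLaws, FluxPatch, SliceTwistWitness, RowFields,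
BalancedSliceTwist, BoxTouch, BoxSpreadPair}` and item 110 `Scaling/ThinSectorsConnected`; nothing is
cited as a fact.

THE CURRENCY GAP IT CLOSES (THEORY-2 §4, rows C7 (b″)♯ and C8).  For an exact (`μ`-invariant) Markov
kernel moving only the links of an update set `Λ` whose plaquettes sit at the plane positions `P`, the
tree has the FLUX law `(μ ⊗ κ){Q ≠ Q'} ≤ 2·μ{∃ p ∈ P, dist(U_p, 1) ≥ 2 sin(π/(2·#P))}`
(`Flux.compProd_topCharge_ne_le_of_links_maxPlaquette`, every invariant `μ`), the matching NO-GO above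
that threshold for a wrapping line and for a block (`Flux.not_fluxLaw_sliceLinks_sharp`,
`Flux.not_fluxLaw_boxLinks_sharp`), and the no-go for the `ε`-SECTOR version
(`Flux.not_sectorLaw_sliceLinks_sharp`, `Flux.not_sectorLaw_boxLinks_sharp`) — but the POSITIVE
`ε`-sector law (the currency of the metric tunnelling laws of `Scaling/MetricTunnellingSectors`:
`sector_ε(U) :=` the connected component of `U` in the `ε`-thin set) was open: it needs "same flux
charge ⇒ same `ε`-sector", which is item 110 (`ThinSectors.connectedComponentIn_thin_eq_iff`).

THE LAW (this file).  For every finite `Λ`, every non-empty `P` containing the positions of the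
plaquettes touching `Λ`, every threshold `c ≤ 2 sin(π/(2·#P))` and every `ε` with `c ≤ ε ≤ 2`, every
s-finite `μ` and every `μ`-invariant Markov kernel `κ` moving only the links of `Λ`:

  `(μ ⊗ κ){sector_ε(U) ≠ sector_ε(U')} ≤ 2·μ{∃ p ∈ P, dist(U_p, 1) ≥ c}`

(`compProd_thinSector_ne_le_of_links`) — the SAME right-hand side as the flux law: the separating set
of the flux law also separates the `ε`-sectors, because a `P`-local move between two configurations
whose `P`-plaquettes are all below `c ≤ ε` preserves the flux charge (pigeonhole,
`Flux.pi_le_sum_abs_or_of_topCharge_ne`) AND preserves `ε`-thinness (the plaquettes off `P` do not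
move), so either both endpoints are `ε`-thin with equal charge — same `ε`-sector by item 110 — or both
are not `ε`-thin — both "sectors" are the empty set.  Instances: the wrapping line
(`sectorLaw_sliceLinks_sharp`, threshold `2 sin(π/(2L))`) and the `l`-block (`sectorLaw_boxLinks_sharp`,
threshold `2 sin(π/(2(l−1)(l+3)))`, `2 ≤ l`, `l + 1 ≤ L`); with the tree's no-go theorems the
`ε`-SECTOR thresholds are PINNED at the flux thresholds for every `ε` strictly above them and `≤ 2`
(`sectorThreshold_sliceLinks_pinned`, `sectorThreshold_boxLinks_pinned`).

HONEST SCOPE: `U(1)`, `d = 2`, periodic `L × L` lattice; one-step stationary tunnelling probabilities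
of exact samplers; no statement about mixing times, about `SU(N)` or about `d = 4`.
-/

noncomputable section

namespace Summit.Ventures.LatticeQCDFlow.Theory2.Lattice.Flux.ThinSectors

open MeasureTheory ProbabilityTheory Metric Set Filter Topology Real
open scoped ENNReal
open Literature.MathematicalPhysics.QuantumFieldTheory Literature.MathematicalPhysics.QuantumLattice

variable {L : ℕ} [NeZero L]

/-! ## §1. Pointwise: a patch-local pair of sub-threshold configurations shares its `ε`-sector -/

omit [NeZero L] in
/-- Every site of the two-torus is the `(0,1)`-plane site of its coordinates. [folklore] -/
theorem planeSite_coords (x : Site 2 L) : planeSite (0 : Site 2 L) 0 1 (x 0, x 1) = x := by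
  ext i
  fin_cases i <;> simp [planeSite]

omit [NeZero L] in
/-- **Thinness transfers across a patch-local move whose patch plaquettes stay below `c ≤ ε`.**
[folklore] -/
theorem mem_thin_of_off_patch {P : Finset (ZMod L × ZMod L)} {c ε : ℝ} (hcε : c ≤ ε)
    {U U' : GaugeConfig 2 L Circle}
    (hUU' : ∀ p ∉ P, plaquetteHolonomy U (planeSite (0 : Site 2 L) 0 1 p) 0 1 =
      plaquetteHolonomy U' (planeSite (0 : Site 2 L) 0 1 p) 0 1)
    (hU' : ∀ p ∈ P, dist (plaquetteHolonomy U' (planeSite (0 : Site 2 L) 0 1 p) 0 1) 1 < c)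
    (hU : U ∈ Thin L ε) : U' ∈ Thin L ε := by
  intro q
  obtain ⟨h0, h1⟩ := plaquette_dirs_eq q
  rw [h0, h1]
  have hx : planeSite (0 : Site 2 L) 0 1 (q.1 0, q.1 1) = q.1 := planeSite_coords q.1
  by_cases hq : (q.1 0, q.1 1) ∈ P
  · have h := hU' _ hq
    rw [hx] at h
    exact h.trans_le hcε
  · have h := hUU' _ hq
    rw [hx] at h
    rw [← h]
    have hUq := hU q
    rwa [h0, h1] at hUq

/-- **Pointwise separation for `ε`-sectors.**  If two configurations agree on every plaquette off the
patch `P`, all their `P`-plaquettes are within `c` of `1`, `c ≤ 2 sin(π/(2·#P))` and `c ≤ ε ≤ 2`, then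
they lie in the same connected component of `Thin L ε` (both components being empty when the common
off-patch plaquettes are not `ε`-thin). [folklore] -/
theorem connectedComponentIn_thin_eq_of_off_patch {P : Finset (ZMod L × ZMod L)} (hPne : P.Nonempty)
    {c ε : ℝ} (hc : c ≤ 2 * Real.sin (π / (2 * P.card))) (hcε : c ≤ ε) (hε2 : ε ≤ 2)
    {U U' : GaugeConfig 2 L Circle}
    (hUU' : ∀ p ∉ P, plaquetteHolonomy U (planeSite (0 : Site 2 L) 0 1 p) 0 1 =
      plaquetteHolonomy U' (planeSite (0 : Site 2 L) 0 1 p) 0 1)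
    (hU : ∀ p ∈ P, dist (plaquetteHolonomy U (planeSite (0 : Site 2 L) 0 1 p) 0 1) 1 < c)
    (hU' : ∀ p ∈ P, dist (plaquetteHolonomy U' (planeSite (0 : Site 2 L) 0 1 p) 0 1) 1 < c) :
    connectedComponentIn (Thin L ε) U = connectedComponentIn (Thin L ε) U' := by
  -- the flux charge does not change (pigeonhole in the flux currency)
  have hQ : topCharge (0 : Site 2 L) 0 1 U = topCharge (0 : Site 2 L) 0 1 U' := by
    by_contra hQ
    rcases pi_le_sum_abs_or_of_topCharge_ne (0 : Site 2 L) 0 1 hUU' hQ with h | h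
    · obtain ⟨p, hp, hle⟩ := exists_dist_ge_of_pi_le_sum (0 : Site 2 L) 0 1 hPne U h
      linarith [hU p hp]
    · obtain ⟨p, hp, hle⟩ := exists_dist_ge_of_pi_le_sum (0 : Site 2 L) 0 1 hPne U' h
      linarith [hU' p hp]
  by_cases hUt : U ∈ Thin L ε
  · have hU't : U' ∈ Thin L ε := mem_thin_of_off_patch hcε hUU' hU' hUt
    exact (connectedComponentIn_thin_eq_iff hε2 hUt hU't).mpr hQ
  · have hU't : U' ∉ Thin L ε := fun h =>
      hUt (mem_thin_of_off_patch hcε (fun p hp => (hUU' p hp).symm) hU h)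
    rw [connectedComponentIn_eq_empty hUt, connectedComponentIn_eq_empty hU't]

/-! ## §2. The `ε`-sector law for link-local exact samplers -/

/-- **THE `ε`-SECTOR TUNNELLING LAW AT THE FLUX THRESHOLD.**  A `μ`-invariant Markov kernel whose
steps change only the links of `Λ` changes the `ε`-sector (`c ≤ ε ≤ 2`) with stationary probability
`≤ 2·μ{∃ p ∈ P, dist(U_p, 1) ≥ c}` for every `c ≤ 2 sin(π/(2·#P))`, `P` any non-empty set of plane
positions containing those whose plaquette touches `Λ` — the same bound as the flux law
`Flux.compProd_topCharge_ne_le_of_links_maxPlaquette`. [folklore] -/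
theorem compProd_thinSector_ne_le_of_links (Λ : Finset (Edge 2 L)) {P : Finset (ZMod L × ZMod L)}
    (hPne : P.Nonempty) (hP : ∀ p, (∃ e ∈ plaqLinks (planeSite (0 : Site 2 L) 0 1 p) 0 1, e ∈ Λ) → p ∈ P)
    {c ε : ℝ} (hc : c ≤ 2 * Real.sin (π / (2 * P.card))) (hcε : c ≤ ε) (hε2 : ε ≤ 2)
    (m : Measure (GaugeConfig 2 L Circle)) [SFinite m]
    (κ : Kernel (GaugeConfig 2 L Circle) (GaugeConfig 2 L Circle)) [IsMarkovKernel κ]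
    (hinv : κ.Invariant m) (hloc : ∀ᵐ q ∂(m ⊗ₘ κ), ∀ e ∉ Λ, q.1 e = q.2 e) :
    (m ⊗ₘ κ) {q | connectedComponentIn (Thin L ε) q.1 ≠ connectedComponentIn (Thin L ε) q.2} ≤
      2 * m {U | ∃ p ∈ P, c ≤ dist (plaquetteHolonomy U (planeSite (0 : Site 2 L) 0 1 p) 0 1) 1} := by
  refine Tunnelling.compProd_chargeChange_le_of_invariant
    (R := fun U U' : GaugeConfig 2 L Circle => ∀ p ∉ P,
      plaquetteHolonomy U (planeSite (0 : Site 2 L) 0 1 p) 0 1 =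
        plaquetteHolonomy U' (planeSite (0 : Site 2 L) 0 1 p) 0 1)
    (Q := fun U : GaugeConfig 2 L Circle => connectedComponentIn (Thin L ε) U)
    (B := {U | ∃ p ∈ P, c ≤ dist (plaquetteHolonomy U (planeSite (0 : Site 2 L) 0 1 p) 0 1) 1})
    (fun U U' hUU' hne => ?_) m κ hinv ?_
  · by_contra h
    simp only [not_or, Set.mem_setOf_eq, not_exists, not_and, not_le] at h
    exact hne (connectedComponentIn_thin_eq_of_off_patch hPne hc hcε hε2 hUU' h.1 h.2)
  · filter_upwards [hloc] with q hq
    exact plaquette_eq_off_patch_of_links hP hq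

/-- The `ε`-sector law with the thick event over ALL plaquettes (the shape of the tree's no-go
theorems). [folklore] -/
theorem compProd_thinSector_ne_le_of_links' (Λ : Finset (Edge 2 L)) {P : Finset (ZMod L × ZMod L)}
    (hPne : P.Nonempty) (hP : ∀ p, (∃ e ∈ plaqLinks (planeSite (0 : Site 2 L) 0 1 p) 0 1, e ∈ Λ) → p ∈ P)
    {c ε : ℝ} (hc : c ≤ 2 * Real.sin (π / (2 * P.card))) (hcε : c ≤ ε) (hε2 : ε ≤ 2)
    (m : Measure (GaugeConfig 2 L Circle)) [SFinite m]
    (κ : Kernel (GaugeConfig 2 L Circle) (GaugeConfig 2 L Circle)) [IsMarkovKernel κ]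
    (hinv : κ.Invariant m) (hloc : ∀ᵐ q ∂(m ⊗ₘ κ), ∀ e ∉ Λ, q.1 e = q.2 e) :
    (m ⊗ₘ κ) {q | connectedComponentIn (Thin L ε) q.1 ≠ connectedComponentIn (Thin L ε) q.2} ≤
      2 * m {U | ∃ p : Plaquette 2 L, c ≤ dist (plaquetteHolonomy U p.1 p.2.1.1 p.2.1.2) 1} := by
  refine (compProd_thinSector_ne_le_of_links Λ hPne hP hc hcε hε2 m κ hinv hloc).trans
    (mul_le_mul_right (measure_mono ?_) 2)
  rintro U ⟨p, -, hp⟩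
  exact ⟨⟨planeSite (0 : Site 2 L) 0 1 p, ⟨(0, 1), by decide⟩⟩, hp⟩

/-! ## §3. The wrapping line and the block: `ε`-sector thresholds pinned -/

/-- **`ε`-SECTOR LAW ON A WRAPPING LINE AT `2 sin(π/(2L))`** (`2 sin(π/(2L)) ≤ ε ≤ 2`): every invariant
pair moving only `sliceLinks L` changes the `ε`-sector with probability
`≤ 2·μ{∃ p, dist(U_p,1) ≥ 2 sin(π/(2L))}`. [folklore] -/
theorem sectorLaw_sliceLinks_sharp {ε : ℝ} (hε : 2 * Real.sin (π / (2 * L)) ≤ ε) (hε2 : ε ≤ 2)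
    (μ : Measure (GaugeConfig 2 L Circle)) [SFinite μ]
    (κ : Kernel (GaugeConfig 2 L Circle) (GaugeConfig 2 L Circle)) [IsMarkovKernel κ]
    (hinv : κ.Invariant μ) (hloc : ∀ᵐ q ∂(μ ⊗ₘ κ), ∀ e ∉ sliceLinks L, q.1 e = q.2 e) :
    (μ ⊗ₘ κ) {q | connectedComponentIn (Thin L ε) q.1 ≠ connectedComponentIn (Thin L ε) q.2} ≤
      2 * μ {U | ∃ p : Plaquette 2 L,
        2 * Real.sin (π / (2 * L)) ≤ dist (plaquetteHolonomy U p.1 p.2.1.1 p.2.1.2) 1} := by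
  have hne : (linePositions L).Nonempty := ⟨(0, 0), mem_linePositions.mpr rfl⟩
  have h := compProd_thinSector_ne_le_of_links' (sliceFinset L) hne (mem_linePositions_of_touch)
    (c := 2 * Real.sin (π / (2 * L))) (by rw [card_linePositions]) hε hε2 μ κ hinv (by
      filter_upwards [hloc] with q hq e he
      exact hq e (by rwa [mem_sliceFinset] at he))
  exact h

/-- **THE LINE'S `ε`-SECTOR THRESHOLD, PINNED** (`2 ≤ L`, `2 sin(π/(2L)) < ε ≤ 2`): the `ε`-sector law
holds at `c⋆ = 2 sin(π/(2L))` with constant `2` for every invariant pair moving only the wrapping line,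
and for every `c > c⋆` no constant works (`Flux.not_sectorLaw_sliceLinks_sharp`). [folklore] -/
theorem sectorThreshold_sliceLinks_pinned (hL : 2 ≤ L) {ε : ℝ} (hε : 2 * Real.sin (π / (2 * L)) < ε)
    (hε2 : ε ≤ 2) :
    (∀ (μ : Measure (GaugeConfig 2 L Circle)) [IsProbabilityMeasure μ]
        (κ : Kernel (GaugeConfig 2 L Circle) (GaugeConfig 2 L Circle)) [IsMarkovKernel κ],
        κ.Invariant μ → (∀ᵐ q ∂(μ ⊗ₘ κ), ∀ e ∉ sliceLinks L, q.1 e = q.2 e) →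
        (μ ⊗ₘ κ) {q | connectedComponentIn (Thin L ε) q.1 ≠
            connectedComponentIn (Thin L ε) q.2} ≤
          2 * μ {U | ∃ p : Plaquette 2 L,
            2 * Real.sin (π / (2 * L)) ≤ dist (plaquetteHolonomy U p.1 p.2.1.1 p.2.1.2) 1}) ∧
    ∀ c : ℝ, 2 * Real.sin (π / (2 * L)) < c → ∀ C : ℝ≥0∞,
      ¬ ∀ (μ : Measure (GaugeConfig 2 L Circle)) [IsProbabilityMeasure μ]
          (κ : Kernel (GaugeConfig 2 L Circle) (GaugeConfig 2 L Circle)) [IsMarkovKernel κ],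
          κ.Invariant μ → (∀ᵐ q ∂(μ ⊗ₘ κ), ∀ e ∉ sliceLinks L, q.1 e = q.2 e) →
          (μ ⊗ₘ κ) {q | connectedComponentIn (Thin L ε) q.1 ≠
              connectedComponentIn (Thin L ε) q.2} ≤
            C * μ {W | ∃ p : Plaquette 2 L,
              c ≤ dist (plaquetteHolonomy W p.1 p.2.1.1 p.2.1.2) 1} :=
  ⟨fun μ _ κ _ hinv hloc => sectorLaw_sliceLinks_sharp hε.le hε2 μ κ hinv hloc,
    fun _ hc C => not_sectorLaw_sliceLinks_sharp hL hc hε hε2 C⟩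

/-- **`ε`-SECTOR LAW ON AN `l`-BLOCK AT `2 sin(π/(2(l−1)(l+3)))`** (`2 ≤ l`, `l + 1 ≤ L`,
`2 sin(π/(2(l−1)(l+3))) ≤ ε ≤ 2`): every invariant pair moving only `boxLinks 1 l` changes the
`ε`-sector with probability `≤ 2·μ{∃ p, dist(U_p,1) ≥ 2 sin(π/(2(l−1)(l+3)))}`. [folklore] -/
theorem sectorLaw_boxLinks_sharp {l : ℕ} (hl : 2 ≤ l) (hlL : l + 1 ≤ L) {ε : ℝ}
    (hε : 2 * Real.sin (π / (2 * (((l : ℝ) - 1) * ((l : ℝ) + 3)))) ≤ ε) (hε2 : ε ≤ 2)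
    (μ : Measure (GaugeConfig 2 L Circle)) [SFinite μ]
    (κ : Kernel (GaugeConfig 2 L Circle) (GaugeConfig 2 L Circle)) [IsMarkovKernel κ]
    (hinv : κ.Invariant μ) (hloc : ∀ᵐ q ∂(μ ⊗ₘ κ), ∀ e ∉ boxLinks (1 : Site 2 L) l, q.1 e = q.2 e) :
    (μ ⊗ₘ κ) {q | connectedComponentIn (Thin L ε) q.1 ≠ connectedComponentIn (Thin L ε) q.2} ≤
      2 * μ {U | ∃ p : Plaquette 2 L, 2 * Real.sin (π / (2 * (((l : ℝ) - 1) * ((l : ℝ) + 3)))) ≤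
        dist (plaquetteHolonomy U p.1 p.2.1.1 p.2.1.2) 1} := by
  have h11 : ((1 : ℕ), (1 : ℕ)) ∈ boxPositionsNat l := by
    unfold boxPositionsNat
    simp only [Finset.mem_filter, Finset.mem_product, Finset.mem_range]
    omega
  have hne : (boxPositions l L).Nonempty := ⟨_, Finset.mem_image_of_mem _ h11⟩
  have hcard : (1 : ℝ) ≤ (boxPositions l L).card := by exact_mod_cast Finset.card_pos.mpr hne
  exact compProd_thinSector_ne_le_of_links' (boxFinset l L) hne (mem_boxPositions_of_touch hl hlL)
    (two_sin_le_two_sin hcard (card_boxPositions_le hl)) hε hε2 μ κ hinv (by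
      filter_upwards [hloc] with q hq e he
      exact hq e (by rwa [mem_boxFinset] at he))

/-- **THE BLOCK'S `ε`-SECTOR THRESHOLD, PINNED** (`2 ≤ l`, `2l + 2 ≤ L`,
`2 sin(π/(2(l−1)(l+3))) < ε ≤ 2`): the `ε`-sector law holds at `c⋆(l) = 2 sin(π/(2(l−1)(l+3)))` with
constant `2` for every invariant pair moving only the block, and for every `c > c⋆(l)` no constant works
(`Flux.not_sectorLaw_boxLinks_sharp`). [folklore] -/
theorem sectorThreshold_boxLinks_pinned {l : ℕ} (hl : 2 ≤ l) (hlL : 2 * l + 2 ≤ L) {ε : ℝ}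
    (hε : 2 * Real.sin (π / (2 * (((l : ℝ) - 1) * ((l : ℝ) + 3)))) < ε) (hε2 : ε ≤ 2) :
    (∀ (μ : Measure (GaugeConfig 2 L Circle)) [IsProbabilityMeasure μ]
        (κ : Kernel (GaugeConfig 2 L Circle) (GaugeConfig 2 L Circle)) [IsMarkovKernel κ],
        κ.Invariant μ → (∀ᵐ q ∂(μ ⊗ₘ κ), ∀ e ∉ boxLinks (1 : Site 2 L) l, q.1 e = q.2 e) →
        (μ ⊗ₘ κ) {q | connectedComponentIn (Thin L ε) q.1 ≠
            connectedComponentIn (Thin L ε) q.2} ≤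
          2 * μ {U | ∃ p : Plaquette 2 L, 2 * Real.sin (π / (2 * (((l : ℝ) - 1) * ((l : ℝ) + 3)))) ≤
            dist (plaquetteHolonomy U p.1 p.2.1.1 p.2.1.2) 1}) ∧
    ∀ c : ℝ, 2 * Real.sin (π / (2 * (((l : ℝ) - 1) * ((l : ℝ) + 3)))) < c → ∀ C : ℝ≥0∞,
      ¬ ∀ (μ : Measure (GaugeConfig 2 L Circle)) [IsProbabilityMeasure μ]
          (κ : Kernel (GaugeConfig 2 L Circle) (GaugeConfig 2 L Circle)) [IsMarkovKernel κ],
          κ.Invariant μ → (∀ᵐ q ∂(μ ⊗ₘ κ), ∀ e ∉ boxLinks (1 : Site 2 L) l, q.1 e = q.2 e) →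
          (μ ⊗ₘ κ) {q | connectedComponentIn (Thin L ε) q.1 ≠
              connectedComponentIn (Thin L ε) q.2} ≤
            C * μ {W | ∃ p : Plaquette 2 L,
              c ≤ dist (plaquetteHolonomy W p.1 p.2.1.1 p.2.1.2) 1} :=
  ⟨fun μ _ κ _ hinv hloc => sectorLaw_boxLinks_sharp hl (by omega) hε.le hε2 μ κ hinv hloc,
    fun _ hc C => not_sectorLaw_boxLinks_sharp hl hlL hc hε hε2 C⟩

end Summit.Ventures.LatticeQCDFlow.Theory2.Lattice.Flux.ThinSectors

end
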